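import Literature.AnabelianGeometry.AbsoluteAnabelian.HolomorphicEllipticCuspidalizationGenusOneHolds
import Literature.AnabelianGeometry.AbsoluteAnabelian.HolomorphicEllipticCuspidalizationTransportProofs
import Literature.AnabelianGeometry.AbsoluteAnabelian.HolomorphicEllipticCuspidalizationTorsionHolds
import Literature.AnabelianGeometry.AbsoluteAnabelian.HolomorphicEllipticCuspidalizationPunctureProofs
import Literature.AnabelianGeometry.AbsoluteAnabelian.HolomorphicEllipticCuspidalizationDeck
import Literature.AnabelianGeometry.AbsoluteAnabelian.HolomorphicEllipticCuspidalizationProofs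
import HarnessLib

/-!
# [AbsTopIII] Cor. 2.7 (b) at the GENUINE punctured elliptic curve (transport from the model tori)

Layer `Literature/AnabelianGeometry/AbsoluteAnabelian`, PROOF-ONLY companion (abc-iut cell, seat
abc-iut-L4-t8, row «COR27-bB-GENUINE») of the [AbsTopIII] Cor. 2.7 sub-DAG statements file
`HolomorphicEllipticCuspidalization.lean` (p414370), which it imports unchanged.  S. Mochizuki, *Topics in
Absolute Anabelian Geometry III*, Cor. 2.7 (b) p.59: "By considering 'elliptic cuspidalization diagrams'
`𝔼 ↩ 𝕌 → 𝔼` … where `𝕌 → 𝔼` is an abelian finite étale covering [which necessarily extends to a covering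
of the one-point compactification of `E^top`] … one may construct the torsion points of [the elliptic
curve determined by] `𝔼` as the points in the complement of the image of such morphisms `𝕌 ↪ 𝔼`, together
with the group structure on these torsion points [which is induced by the group structure of the Galois
group `Gal(𝕌/𝔼)`]" [cite: MochizukiAbsTopIII2015, Corollary 2.7 (b) p.59].

The sub-DAG proved every clause of (b) at the MODEL FAMILY of once-punctured complex tori
`𝔼 = ℂ/Φ(ℤ^ι) ∖ {0}` ((b).1–(b).8, (b).eq, (c).6: p414959, p415902, p416327, p421169, p421429) and proved
that every punctured elliptic curve `E` in the typed (conformal) sense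
`TorsionPointsDenseUniqueGroupLaw.IsPuncturedEllipticCurve E` is biholomorphic to a member of that family
((c).4 `puncturedEllipticCurveModel_holds`, p434051, resting on the genus-one uniformization theorem
`genusOneUniformization_holds`).  This file carries the clauses of (b) across that biholomorphism, so
that they hold AT THE GENUINE OBJECT `E` (and its one-point compactification `OnePoint E`), with no model
in the statement except as the target of an explicit isomorphism:

* `abelianCover_extends_onePoint_of_isPuncturedEllipticCurve` — the bracket «[which necessarily
  extends to a covering of the one-point compactification of `E^top`]»: every finite étale covering
  `q : Y → E` with commutative, fibre-transitive deck group extends to a finite covering of `OnePoint E`,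
  `Y` being the preimage of `E`;
* `exists_groupLaw_of_isPuncturedEllipticCurve` — «the torsion points of [the elliptic curve determined
  by] `𝔼` = the complement points, with the group structure induced by `Gal(𝕌/𝔼)`»: there is a
  commutative topological group law on `OnePoint E` with neutral element the cusp `∞`, continuously and
  (on `E`) holomorphically isomorphic to a complex torus `ℂ/Φ(ℤ²)` of the tree — i.e. an elliptic curve
  with underlying Riemann surface `OnePoint E ⊇ E` — for which `cuspidalTorsionPoints E` is EXACTLY the set
  of points of `E` of finite order, and for every `N ≠ 0` an elliptic cuspidalization diagram over `E` whose
  complement points are the non-zero `N`-torsion points and whose Galois group is isomorphic to the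
  `N`-torsion subgroup.  By Cor. 2.7 (c) (`torsionPointsDenseUniqueGroupLaw_holds`, p433667) this law is
  the unique commutative topological group law on `OnePoint E` with these values on the (dense) cuspidal
  torsion points.

Inputs, all theorems of the tree consumed BY NAME: `puncturedEllipticCurveModel_holds` ((c).4),
`image_cuspidalTorsionPoints_eq` / `EllipticCuspidalizationDiagram.transport` ((c).5),
`abelianCoverOfPuncturedTorusExtends_holds` ((b).7), `cuspidalTorsionPoints_eq` ((b).8/(b).eq),
`onePointPuncturedTorus_holds` ((c).6), `exists_deckGroup_mulEquiv_ker` ((b).3♯),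
`not_mem_range_nsmulImm_iff` ((b).5), Mathlib `Homeomorph.onePointCongr`.  No definitions, no named facts.
HONEST FRAMING: classical complex analysis/topology inside OUR typing of a refereed statement; typed ≠
proved elsewhere; nothing here bears on the disputed [IUTchIII] Cor. 3.12.
-/

noncomputable section

open Set Function
open _root_.Topology _root_.TopologicalSpace _root_.OnePoint
open scoped _root_.Manifold _root_.ContDiff
open Literature.Geometry.Kaehler (ComplexTorus)

namespace Literature.AnabelianGeometry.AbsoluteAnabelian

namespace HolomorphicEllipticCuspidalization

/-! ### §1 Topological transport lemmas -/

section Topological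

variable {E E' Y : Type} [TopologicalSpace E] [TopologicalSpace E'] [TopologicalSpace Y]

/-- A finite étale map stays finite étale after post-composition with a homeomorphism of the base.
[cite: MochizukiAbsTopIII2015, Definition 2.1 (ii) p.51] -/
theorem isFiniteEtale_homeomorph_comp {q : Y → E} (hq : IsFiniteEtale q) (γ : E ≃ₜ E') :
    IsFiniteEtale (γ ∘ q) where
  isCoveringMap := hq.isCoveringMap.homeomorph_comp γ
  finite_fibre y := by
    have : (γ ∘ q) ⁻¹' {y} = q ⁻¹' {γ.symm y} := by
      ext u
      simp only [mem_preimage, mem_singleton_iff, Function.comp_apply]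
      constructor
      · intro h; rw [← h, γ.symm_apply_apply]
      · intro h; rw [h, γ.apply_symm_apply]
    rw [this]
    exact hq.finite_fibre _

/-- Commutativity and fibre-transitivity of the deck group are unchanged by post-composition with a
homeomorphism of the base (the deck group itself is unchanged, `deckGroup_homeomorph_comp`).
[cite: MochizukiAbsTopIII2015, Corollary 2.7 (b) p.59] -/
theorem deck_abelian_transitive_homeomorph_comp {q : Y → E} (γ : E ≃ₜ E')
    (hcomm : ∀ φ ψ : deckGroup q, φ * ψ = ψ * φ)
    (htrans : ∀ y y' : Y, q y = q y' → ∃ φ : deckGroup q, (φ : Y ≃ₜ Y) y = y') :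
    (∀ φ ψ : deckGroup (γ ∘ q), φ * ψ = ψ * φ) ∧
      ∀ y y' : Y, (γ ∘ q) y = (γ ∘ q) y' → ∃ φ : deckGroup (γ ∘ q), (φ : Y ≃ₜ Y) y = y' := by
  have hdeck : deckGroup (γ ∘ q) = deckGroup q := deckGroup_homeomorph_comp q γ
  refine ⟨fun φ ψ => ?_, fun y y' hyy' => ?_⟩
  · have hφ : (φ : Y ≃ₜ Y) ∈ deckGroup q := hdeck ▸ φ.2
    have hψ : (ψ : Y ≃ₜ Y) ∈ deckGroup q := hdeck ▸ ψ.2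
    have h := congrArg Subtype.val (hcomm ⟨φ, hφ⟩ ⟨ψ, hψ⟩)
    exact Subtype.ext h
  · obtain ⟨φ, hφ⟩ := htrans y y' (γ.injective hyy')
    exact ⟨⟨φ, hdeck.symm ▸ φ.2⟩, hφ⟩

end Topological

/-! ### §2 The compactification of a punctured elliptic curve along its model -/

section Compactification

variable {E : Type} [TopologicalSpace E] {ι : Type} [Fintype ι] {Φ : (ι → ℝ) ≃L[ℝ] ℂ}

/-- From a homeomorphism `e : E ≃ₜ 𝔼 = T ∖ {0}` onto a model punctured torus and (c).6
(`OnePoint 𝔼 ≃ₜ T`, `∞ ↦ 0`): a homeomorphism `θ : OnePoint E ≃ₜ T` with `θ ∞ = 0` and `θ x = e x` on `E`.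
[cite: MochizukiAbsTopIII2015, Corollary 2.7 (c) p.59] -/
theorem exists_onePoint_homeomorph_torus (e : E ≃ₜ ↥(puncturedTorus Φ)) :
    ∃ θ : OnePoint E ≃ₜ ComplexTorus Φ,
      θ ∞ = 0 ∧ ∀ x : E, θ x = ((e x : puncturedTorus Φ) : ComplexTorus Φ) := by
  obtain ⟨ē, hē0, hēx⟩ := onePointPuncturedTorus_holds ι Φ
  refine ⟨e.onePointCongr.trans ē, ?_, fun x => ?_⟩
  · rw [Homeomorph.trans_apply, Homeomorph.onePointCongr_apply, OnePoint.map_infty, hē0]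
  · rw [Homeomorph.trans_apply, Homeomorph.onePointCongr_apply, OnePoint.map_some, hēx]

/-- For such a `θ`, a point of `T` corresponds to a point of `E` (not the cusp) iff it is non-zero.
[cite: MochizukiAbsTopIII2015, Corollary 2.7 (c) p.59] -/
theorem symm_mem_range_coe_iff {θ : OnePoint E ≃ₜ ComplexTorus Φ} (hθ : θ ∞ = 0)
    (z : ComplexTorus Φ) : θ.symm z ∈ range ((↑) : E → OnePoint E) ↔ z ∈ (puncturedTorus Φ : Set _) := by
  rw [SetLike.mem_coe, mem_puncturedTorus_iff]
  constructor
  · rintro ⟨x, hx⟩ rfl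
    rw [← hθ, θ.symm_apply_apply] at hx
    exact OnePoint.coe_ne_infty x hx
  · intro hz
    have hne : θ.symm z ≠ (∞ : OnePoint E) := by
      intro h
      apply hz
      rw [← θ.apply_symm_apply z, h, hθ]
    exact OnePoint.ne_infty_iff_exists.1 hne

end Compactification

/-! ### §3 Cor. 2.7 (b) at the genuine punctured elliptic curve -/

section Genuine

variable {E : Type} [TopologicalSpace E] [T2Space E] [ChartedSpace ℂ E] [IsManifold 𝓘(ℂ, ℂ) ω E]

/-- **[AbsTopIII] Cor. 2.7 (b), the bracket «[which necessarily extends to a covering of the one-point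
compactification of `E^top`]», at the GENUINE object**: for every punctured elliptic curve `E` in the typed
sense and every finite étale covering `q : Y → E` whose deck group is commutative and transitive on fibres,
there are a finite covering `qc : Yc → OnePoint E` of the one-point compactification and an open embedding
`j : Y ↪ Yc` over `E ↪ OnePoint E` whose image is the preimage of `E` (transport of (b).7
`abelianCoverOfPuncturedTorusExtends_holds` along (c).4 and (c).6).
[cite: MochizukiAbsTopIII2015, Corollary 2.7 (b) p.59] -/
theorem abelianCover_extends_onePoint_of_isPuncturedEllipticCurve
    (hE : TorsionPointsDenseUniqueGroupLaw.IsPuncturedEllipticCurve E)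
    (Y : Type) [TopologicalSpace Y] (q : Y → E) (hq : IsFiniteEtale q)
    (hcomm : ∀ φ ψ : deckGroup q, φ * ψ = ψ * φ)
    (htrans : ∀ y y' : Y, q y = q y' → ∃ φ : deckGroup q, (φ : Y ≃ₜ Y) y = y') :
    ∃ (Yc : Type) (_ : TopologicalSpace Yc) (qc : Yc → OnePoint E) (j : Y → Yc),
      IsCoveringMap qc ∧ (∀ t, (qc ⁻¹' {t}).Finite) ∧ IsOpenEmbedding j ∧
        (∀ y, qc (j y) = (q y : OnePoint E)) ∧
        Set.range j = qc ⁻¹' Set.range ((↑) : E → OnePoint E) := by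
  obtain ⟨Φ, e, -, -⟩ := puncturedEllipticCurveModel_holds E hE
  obtain ⟨θ, hθ0, hθx⟩ := exists_onePoint_homeomorph_torus e
  obtain ⟨hcomm', htrans'⟩ := deck_abelian_transitive_homeomorph_comp e hcomm htrans
  obtain ⟨Yc, _, qc, j, hqc, hfin, hj, hqj, hrange⟩ :=
    abelianCoverOfPuncturedTorusExtends_holds (Fin 2) Φ Y (e ∘ q) (isFiniteEtale_homeomorph_comp hq e)
      hcomm' htrans'
  refine ⟨Yc, inferInstance, θ.symm ∘ qc, j, hqc.homeomorph_comp θ.symm, fun t => ?_, hj, fun y => ?_, ?_⟩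
  · have : (θ.symm ∘ qc) ⁻¹' {t} = qc ⁻¹' {θ t} := by
      ext u
      simp only [mem_preimage, mem_singleton_iff, Function.comp_apply]
      constructor
      · intro h; rw [← h, θ.apply_symm_apply]
      · intro h; rw [h, θ.symm_apply_apply]
    rw [this]
    exact hfin _
  · rw [Function.comp_apply, hqj y, Function.comp_apply, ← hθx (q y), θ.symm_apply_apply]
  · rw [hrange, Set.preimage_comp]
    congr 1
    ext z
    rw [mem_preimage, symm_mem_range_coe_iff hθ0]

/-- **[AbsTopIII] Cor. 2.7 (b), «the torsion points of [the elliptic curve determined by] `𝔼` as the points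
in the complement of the image of such morphisms `𝕌 ↪ 𝔼`, together with the group structure on these
torsion points [which is induced by the group structure of the Galois group `Gal(𝕌/𝔼)`]», at the GENUINE
object**: for every punctured elliptic curve `E` in the typed sense there is a commutative topological group
law on the one-point compactification `OnePoint E` with neutral element the cusp `∞`, along which
`OnePoint E` is isomorphic, as a topological group and holomorphically on `E`, to a complex torus
`ℂ/Φ(ℤ²)` of the tree (so that it is "the elliptic curve determined by `𝔼`"), such that
(1) the cuspidal torsion points of `E` are EXACTLY the points of `E` of finite order, and
(2) for every `N ≠ 0` some elliptic cuspidalization diagram `𝔼 ↩ 𝕌 → 𝔼` over `E` has as complement points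
exactly the non-zero `N`-torsion points and has Galois group `Gal(𝕌/𝔼)` isomorphic to the `N`-torsion
subgroup.  By Cor. 2.7 (c) (`torsionPointsDenseUniqueGroupLaw_holds`) a commutative topological group law
on `OnePoint E` is determined by its values on the cuspidal torsion points, so this law is the unique one
extending "the group structure on the torsion points of (b)".
[cite: MochizukiAbsTopIII2015, Corollary 2.7 (b) p.59] -/
theorem exists_groupLaw_of_isPuncturedEllipticCurve
    (hE : TorsionPointsDenseUniqueGroupLaw.IsPuncturedEllipticCurve E) :
    ∃ g : AddCommGroup (OnePoint E),
      letI : AddCommGroup (OnePoint E) := g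
      IsTopologicalAddGroup (OnePoint E) ∧ (∞ : OnePoint E) = 0 ∧
      (∃ (Φ : (Fin 2 → ℝ) ≃L[ℝ] ℂ) (ψ : OnePoint E ≃ₜ+ ComplexTorus Φ),
          MDifferentiable 𝓘(ℂ, ℂ) 𝓘(ℂ, ℂ) (fun x : E => ψ x)) ∧
      cuspidalTorsionPoints E = {x : E | IsOfFinAddOrder (x : OnePoint E)} ∧
      ∀ N : ℕ, N ≠ 0 → ∃ D : EllipticCuspidalizationDiagram E,
        (∀ x : E, x ∉ Set.range D.imm ↔ N • (x : OnePoint E) = 0) ∧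
        Nonempty (deckGroup D.cov ≃*
          Multiplicative ((nsmulAddMonoidHom N : OnePoint E →+ OnePoint E).ker)) := by
  obtain ⟨Φ, e, he, he'⟩ := puncturedEllipticCurveModel_holds E hE
  obtain ⟨θ, hθ0, hθx⟩ := exists_onePoint_homeomorph_torus e
  -- transport the group law of `T = ℂ/Φ(ℤ²)` along `θ`
  letI g : AddCommGroup (OnePoint E) := θ.toEquiv.addCommGroup
  let θa : OnePoint E ≃+ ComplexTorus Φ := θ.toEquiv.addEquiv
  have hθa : ∀ w, θa w = θ w := fun _ => rfl
  haveI : IsTopologicalAddGroup (OnePoint E) :=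
    Topology.IsInducing.topologicalAddGroup θa.toAddMonoidHom (by exact θ.isInducing)
  have h0 : (∞ : OnePoint E) = 0 := by
    apply θa.injective
    rw [map_zero, hθa, hθ0]
  have hfin : ∀ x : E, IsOfFinAddOrder (x : OnePoint E) ↔
      IsOfFinAddOrder ((e x : puncturedTorus Φ) : ComplexTorus Φ) := by
    intro x
    rw [← hθx x, ← hθa, ← AddEquiv.coe_toAddMonoidHom,
      θa.injective.isOfFinAddOrder_iff (f := θa.toAddMonoidHom)]
  let ψ : OnePoint E ≃ₜ+ ComplexTorus Φ :=
    { θa with continuous_toFun := θ.continuous, continuous_invFun := θ.symm.continuous }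
  have hψ : ∀ w, ψ w = θ w := fun _ => rfl
  refine ⟨g, inferInstance, h0, ⟨Φ, ψ, ?_⟩, ?_, fun N hN => ?_⟩
  · -- holomorphy on `E`: `ψ x = e x` in `T`, and `E → 𝔼 ↪ T` is holomorphic
    have hval : MDifferentiable 𝓘(ℂ, ℂ) 𝓘(ℂ, ℂ)
        (fun x : E => ((e x : puncturedTorus Φ) : ComplexTorus Φ)) :=
      ((contMDiff_subtype_val (I := 𝓘(ℂ, ℂ)) (n := ω)).mdifferentiable (by simp)).comp he
    have hfun : (fun x : E => ψ x) = fun x => ((e x : puncturedTorus Φ) : ComplexTorus Φ) :=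
      funext fun x => by rw [hψ, hθx]
    rw [hfun]
    exact hval
  · -- (1) cuspidal torsion points = points of finite order
    ext x
    rw [mem_setOf_eq, hfin x, ← mem_cuspidalTorsionPoints_iff Φ (e x),
      ← image_cuspidalTorsionPoints_eq e he he', e.injective.mem_set_image]
  · -- (2) the transported `[N]`-diagram and its Galois group
    have he'' : MDifferentiable 𝓘(ℂ, ℂ) 𝓘(ℂ, ℂ) e.symm.symm := by rw [e.symm_symm]; exact he
    let D₀ : EllipticCuspidalizationDiagram ↥(puncturedTorus Φ) :=
      nsmulDiagram nsmulCovIsFiniteEtale_holds nsmulCovIsMorphism_holds nsmulDeckAbelianTransitive_holds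
        nsmulImmIsMorphism_holds nsmulImmComplement_holds nsmulCoholomorphic_holds Φ N hN
    refine ⟨D₀.transport e.symm he' he'', fun x => ?_, ?_⟩
    · rw [D₀.range_transport_imm e.symm he' he'', Homeomorph.image_eq_preimage_symm,
        Homeomorph.symm_symm, Set.mem_preimage, ← Set.mem_compl_iff]
      change (e x ∈ (range (nsmulImm Φ N))ᶜ ↔ _)
      rw [not_mem_range_nsmulImm_iff Φ N (e x), ← hθx x, ← hθa, ← map_nsmul,
        AddEquiv.map_eq_zero_iff]
    · obtain ⟨ε, -⟩ := exists_deckGroup_mulEquiv_ker Φ hN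
      have hdeck : deckGroup (D₀.transport e.symm he' he'').cov = deckGroup (nsmulCov Φ N) :=
        deckGroup_homeomorph_comp (nsmulCov Φ N) e.symm
      -- the `N`-torsion of `T` and of `OnePoint E` correspond under `θa`
      let κ : (nsmulAddMonoidHom N : ComplexTorus Φ →+ ComplexTorus Φ).ker ≃+
          (nsmulAddMonoidHom N : OnePoint E →+ OnePoint E).ker :=
        { toFun := fun k => ⟨θa.symm k, by
            rw [AddMonoidHom.mem_ker, nsmulAddMonoidHom_apply, ← map_nsmul,
              AddEquiv.map_eq_zero_iff]
            exact k.2⟩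
          invFun := fun k => ⟨θa k, by
            rw [AddMonoidHom.mem_ker, nsmulAddMonoidHom_apply, ← map_nsmul,
              AddEquiv.map_eq_zero_iff]
            exact k.2⟩
          left_inv := fun k => Subtype.ext (θa.apply_symm_apply k)
          right_inv := fun k => Subtype.ext (θa.symm_apply_apply k)
          map_add' := fun k k' => Subtype.ext (map_add θa.symm (k : ComplexTorus Φ) (k' : ComplexTorus Φ)) }
      exact ⟨(MulEquiv.subgroupCongr hdeck).trans (ε.trans (AddEquiv.toMultiplicative κ))⟩

end Genuine

end HolomorphicEllipticCuspidalization

end Literature.AnabelianGeometry.AbsoluteAnabelian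

end
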